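import Mathlib
import Literature.ModelTheory.FiniteModelTheory.ESO
import Summits.PneNP.PneNP.Theorems.ExpanderLinearGeneratorsNoPolyBoundedProofSystemFagin

/-!
# Sketch — crux idea `ajtai-fagin-arity-ladder` for stmt-PneNP-0097 (X = NoPolyBoundedProofSystem)

First-lemma signatures (elaboration check only; `sorry` allowed here, this is not a skeleton).
-/

set_option linter.dupNamespace false

namespace Summit.PneNP.PneNP.Cruxes.ProofcplxThesis.AjtaiFaginArityLadder

open Literature.ModelTheory.FiniteModelTheory Literature.Computability.Cryptography
open Summit.PneNP.PneNP.Theses.ExpanderLinearGenerators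

/-- `∃SO` definability with all second-order witnesses of arity `≤ k`
(`k = 1`: monadic NP; `k = 2`: binary NP). -/
def IsESODefinableArity (k : ℕ) (ar : List ℕ) (C : Set (SNPInstance ar)) : Prop :=
  ∃ Φ : ESOSentence ar, (∀ a ∈ Φ.witnessArities, a ≤ k) ∧ Φ.modelClass = C

/-- The vocabulary of graphs: one binary relation symbol. -/
abbrev graphVocab : List ℕ := [2]

/-- The simple graph carried by a `[2]`-table structure on `Fin n` (symmetrised, loops dropped). -/
def graphOfTables {n : ℕ} (R : RelTables graphVocab n) : SimpleGraph (Fin n) :=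
  SimpleGraph.fromRel fun a b : Fin n => R ⟨0, by decide⟩ ![a, b] = true

/-- The class of finite graphs that are NOT properly 3-colourable. -/
def non3Col : Set (SNPInstance graphVocab) :=
  {x | ¬ (graphOfTables x.2).Colorable 3}

/-- The class of 3-colourable finite graphs (an `∃MSO` class: guess three unary predicates). -/
def threeCol : Set (SNPInstance graphVocab) :=
  {x | (graphOfTables x.2).Colorable 3}

theorem non3Col_eq_compl : non3Col = threeColᶜ := rfl

theorem le_foldr_max_of_mem : ∀ (l : List ℕ) (a : ℕ), a ∈ l → a ≤ l.foldr max 0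
  | [], a, ha => by simp at ha
  | b :: l, a, ha => by
      simp only [List.foldr_cons]
      rcases List.mem_cons.1 ha with rfl | h
      · exact le_max_left _ _
      · exact le_trans (le_foldr_max_of_mem l a h) (le_max_right _ _)

/-- Arity-graded definability exhausts `∃SO` definability (take `k` = the maximal witness arity). -/
theorem isESODefinable_iff_exists_arity (ar : List ℕ) (C : Set (SNPInstance ar)) :
    IsESODefinable ar C ↔ ∃ k, IsESODefinableArity k ar C := by
  constructor
  · rintro ⟨Φ, hΦ⟩
    exact ⟨Φ.witnessArities.foldr max 0, Φ, fun a ha => le_foldr_max_of_mem _ a ha, hΦ⟩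
  · rintro ⟨k, Φ, -, hΦ⟩
    exact ⟨Φ, hΦ⟩

/-- RUNG 1 (monadic; KNOWN — Libkin, *Elements of FMT*, Ex. 7.12): non-3-colourability is not in
monadic NP.  New proof device proposed by the card: 4-critical high-girth hosts + a
type-preserving 2-switch found by pigeonhole over Hanf types. -/
theorem rung_monadic : ¬ IsESODefinableArity 1 graphVocab non3Col := by
  sorry

/-- RUNG 1½ (moderate degree; NEW target, believed provable with Schwentick-type locality):
for every arity-2 certificate format whose guessed relations have maximum degree `≤ D n` with
`D n = n^{o(1)}`, Duplicator wins.  Typed here in the crude form "witness relations of arity 2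
are only ever evaluated … " is NOT expressible by a syntactic restriction of `ESOSentence`, so the
rung is stated semantically: no `∃SO₂` sentence defines NON-3-COL even when its models are only
required to be correct on graphs of maximum degree `≤ d` (bounded-degree hosts suffice for the
Duplicator).  -/
theorem rung_binary_on_bounded_degree_hosts_suffices (d : ℕ) :
    (¬ ∃ Φ : ESOSentence graphVocab, (∀ a ∈ Φ.witnessArities, a ≤ 2) ∧
        ∀ x : SNPInstance graphVocab, (∀ v, ((graphOfTables x.2).neighborSet v).ncard ≤ d) →
          (x ∈ Φ.modelClass ↔ x ∈ non3Col)) →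
    ¬ IsESODefinableArity 2 graphVocab non3Col := by
  rintro h ⟨Φ, hΦ, hC⟩
  exact h ⟨Φ, hΦ, fun x _ => by rw [hC]⟩

/-- COMPOSITION (kernel-checkable today modulo two routine facts about `threeCol`):
if NON-3-COL escapes every arity rung, then X.  Uses the in-tree Fagin bridge
`noPolyBoundedProofSystem_of_not_isESODefinable_compl`. -/
theorem noPolyBoundedProofSystem_of_all_rungs
    (hiso : IsIsoClosedStr graphVocab threeCol)
    (hdef : IsESODefinable graphVocab threeCol)
    (hrungs : ∀ k, ¬ IsESODefinableArity k graphVocab non3Col) :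
    NoPolyBoundedProofSystem := by
  have har : IsNondegenerateVocab graphVocab := ⟨2, by simp [graphVocab], by norm_num⟩
  refine Summit.PneNP.PneNP.Theorems.noPolyBoundedProofSystem_of_not_isESODefinable_compl
    har hiso hdef ?_
  intro hc
  obtain ⟨k, hk⟩ := (isESODefinable_iff_exists_arity _ _).1 hc
  exact hrungs k (non3Col_eq_compl ▸ hk)


/-! ### Card `null-model-hosts-profile-transplant`: the average-case reduction of every rung -/

/-- Graphs that are NOT properly `q`-colourable (`q = 3` recovers `non3Col`). -/
def nonQCol (q : ℕ) : Set (SNPInstance graphVocab) :=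
  {x | ¬ (graphOfTables x.2).Colorable q}

theorem nonQCol_three : nonQCol 3 = non3Col := rfl

/-- AVERAGE-CASE REDUCTION (the logical core of the card; the probability lives in the choice of
the host family `𝒟 ⊆ nonQCol q`, e.g. typical random `d`-regular graphs with `6 ≤ d ≤ 14`): if
every SOUND arity-`k` certificate format (`Φ.modelClass ⊆ nonQCol q`) misses some host of the
family, then rung `k` holds for NON-`q`-COL. -/
theorem rung_of_hostFamily {q k : ℕ} (𝒟 : Set (SNPInstance graphVocab)) (h𝒟 : 𝒟 ⊆ nonQCol q)
    (h : ∀ Φ : ESOSentence graphVocab, (∀ a ∈ Φ.witnessArities, a ≤ k) →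
      Φ.modelClass ⊆ nonQCol q → ∃ x ∈ 𝒟, x ∉ Φ.modelClass) :
    ¬ IsESODefinableArity k graphVocab (nonQCol q) := by
  rintro ⟨Φ, hΦ, hC⟩
  obtain ⟨x, hx𝒟, hxΦ⟩ := h Φ hΦ (hC ▸ subset_rfl)
  exact hxΦ (hC.symm ▸ h𝒟 hx𝒟)

end Summit.PneNP.PneNP.Cruxes.ProofcplxThesis.AjtaiFaginArityLadder
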